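import Summits.BirchSwinnertonDyer.Rank1Residual.P2.HeegnerIndexAtTwo
import HarnessLib

/-!
# Route ByReductionTypeAtTwo, crux `RankOneAtTwoBigImageOddLocal` (stmt-BirchSwinnertonDyer-23715), LINE v8.2 `one_door_analytic`:
# the tree door `P2.bsdp_two_iff_of_heegner_rankOne` with its GZK binder replaced by the ONE consequence it uses

Width prover seat `bsd-line-fkl-p2` g7 (2026-08-28), `--supports stmt-BirchSwinnertonDyer-23715`.  Purpose: shrink the PRINT cone of
the crux assembly `rankOneAtTwoBigImageOddLocal_of_oneDoorAnalytic_primary` (`…OneDoorAnalyticAssembly.lean`, p618446) from six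
named facts to four PRIMARY printed theorems (Gross–Zagier, Kolyvagin, modularity as a newform, Hoffstein–Luo 1997).

The door of sub-lane «bsd-p2», `Summit.BirchSwinnertonDyer.Rank1Residual.P2.shaAn_eq_heegnerIndexFormula_two` /
`…bsdp_two_iff_of_heegner_rankOne` (`Rank1Residual/P2/HeegnerIndexAtTwo.lean`), carries the GLOBAL named fact
`rank_eq_analyticRank_of_analyticRank_le_one` (GZK over `ℚ` for EVERY curve of analytic rank `≤ 1` — a COMPOSITE fact: its
rank-`0` half needs Murty–Murty / Bump–Friedberg–Hoffstein) as the binder `hGZK`, but USES it exactly once, for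
`W.mordellWeilRank = 1` of the ONE curve `W` of analytic rank `1` at hand (its l.160; `bsdp_two_iff_of_heegner_rankOne` l.317
re-derives the same equality).  This file re-proves both statements VERBATIM with that binder replaced by the local hypothesis
`hrQ : W.mordellWeilRank = 1` (proof text = the tree's, minus the two `hGZK` lines; credit: sub-lane «bsd-p2» typer, GEN 2).
Downstream (`…OneDoorAnalyticPrimary.lean`) `hrQ` is DERIVED on the slice from Gross–Zagier + Kolyvagin + Hoffstein–Luo +
modularity through the tree's PROVED Darmon Prop. 3.11 (`heegnerPoint_conj_add_rootNumber_smul_of_atkinLehner`), so that the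
crux needs neither the composite GZK fact nor `hasEntireLFunction_rat` (`= hasEntireLFunction_rat_of_modularity`).

* `shaAn_eq_heegnerIndexFormula_two_of_rank` — `#Ш(E)_an = 8 I² t_W² / (n k² t_K² c² w² q_d |u| c_W)` exactly, binders
  `hGZ`, `hKo`, `hrQ`, `hmod`.
* `bsdp_two_iff_of_heegner_rankOne_of_rank` — `BSD(E, 2) ⟺` one explicit `2`-adic valuation, same binders.

A per-pair statement; it closes no class; nothing is asserted (every published input is an explicit binder).  BSD is not
proved by any of this.

References: Gross–Zagier 1986 Thm I.6.3, V.§2 [GrossZagier1986]; Jetchev–Skinner–Wan 2017 §7.4.1 [JetchevSkinnerWan2017];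
Kolyvagin 1990 Thm A [Kolyvagin1990]; Miller 2011 Def 1.1 [Miller2011LMS].
-/

noncomputable section

open scoped Classical

open WeierstrassCurve NumberField Literature.NumberTheory.EllipticCurves
  Literature.NumberTheory.EllipticCurves.ModularForms
  Literature.NumberTheory.EllipticCurves.Rank1Residual
  Literature.NumberTheory.EllipticCurves.KrizLi2019
  Literature.NumberTheory.QuadraticFields
  Summit.BirchSwinnertonDyer.Rank1Residual.P2

set_option autoImplicit false
set_option linter.dupNamespace false

namespace Summit.BirchSwinnertonDyer.BirchSwinnertonDyer.Theorems.RankOneAtTwoOneDoor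

/-- **THE EXACT `2`-ADIC GROSS–ZAGIER INDEX FORMULA (analytic rank one, as an equality in `ℚ`), GZK binder replaced by
`hrQ : W.mordellWeilRank = 1`** — verbatim `Summit.BirchSwinnertonDyer.Rank1Residual.P2.shaAn_eq_heegnerIndexFormula_two` otherwise.
Data: `W/ℚ` globally minimal with `ord_{s=1} L(E,s) = 1`; `K` imaginary quadratic with the Heegner
hypothesis for `N`; `P ∈ E(K)` the Heegner point of a parametrisation datum `Dt` (Manin constant
`c = Dt.c ≠ 0`); `L(E^{d_K},1) ≠ 0`; `Wd = Cd • W^{(d_K)}` a globally minimal model of the twist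
(scalar `u = Cd.u`); a rational `q_d` with `L(E^{d_K},1)/Ω_{E^{d_K}} = q_d`. PUBLISHED inputs as
binders: `hGZ`, `hKo`, `hmod`; and `hrQ : rank E(ℚ) = 1` (the only consequence of GZK over `ℚ` the tree's proof uses).
CONCLUSION: `Ш(E/ℚ)` is finite (Kolyvagin over `K`) and there is `k ∈ {1, 2}`,
`k = 2` iff every rational point is halvable in `E(K)` modulo torsion, with
`#Ш(E)_an = 8 · I² · t_W² / (n · k² · t_K² · c² · w² · q_d · |u| · c_W)` EXACTLY, where
`I = [E(K):ℤP]`, `t_W = #E(ℚ)_tor`, `t_K = #E(K)_tor`, `n = #π₀(E(ℝ)) ∈ {1,2}`, `w = #𝒪_K^×`,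
`c_W = ∏_ℓ c_ℓ(E)`. (The tree's odd-`p` identity is this formula's valuation with the `2`-power
factors dropped.) [cite: JetchevSkinnerWan2017, §7.4.1 (eq:gz for K′), pp. 29–30]
[cite: GrossZagier1986, Thm. I.6.3 and V.§2 (pp. 310–312)] [cite: Miller2011LMS, §1 (definition of #Ш_an)] -/
theorem shaAn_eq_heegnerIndexFormula_two_of_rank
    (W : WeierstrassCurve ℚ) [W.IsElliptic] [W.IsGloballyMinimal]
    (N : ℕ) [NeZero N] (K : Type) [Field K] [NumberField K]
    (Dt : ModularParametrizationData W N) (H : HeegnerDatum N (NumberField.discr K)) (ι : K →+* ℂ)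
    (P : (W.baseChange K).toAffine.Point)
    -- the published inputs (named facts of the tree)
    (hGZ : gross_zagier N W K) (hKo : kolyvagin N W K) (hmod : hasEntireLFunction_rat)
    -- the data
    (hK : IsImaginaryQuadratic K) (hHN : SatisfiesHeegnerHypothesis N K)
    (hP : WeierstrassCurve.Affine.Point.map ι.toRatAlgHom P = heegnerPointComplex Dt H)
    (hc0 : Dt.c ≠ 0) (hr : W.analyticRank = 1) (hrQ : W.mordellWeilRank = 1)
    (hLt : (W.quadraticTwist (NumberField.discr K : ℚ)).entireLFunction 1 ≠ 0)
    (Wd : WeierstrassCurve ℚ) [Wd.IsElliptic] [Wd.IsGloballyMinimal] (Cd : VariableChange ℚ)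
    (hWd : Cd • W.quadraticTwist (NumberField.discr K : ℚ) = Wd)
    (qd : ℚ) (hqd : Wd.entireLFunction 1 / (Wd.realPeriodRat : ℂ) = (qd : ℂ)) :
    Finite W.sha ∧
      ∃ k : ℕ, (k = 1 ∨ k = 2) ∧
        (k = 2 ↔ ∀ y : W.toAffine.Point, ∃ Q : (W.baseChange K).toAffine.Point,
          QuadraticDescent.incl K W y - (2 : ℤ) • Q ∈
            AddCommGroup.torsion (W.baseChange K).toAffine.Point) ∧
        shaAn W =
          ((8 * ((AddSubgroup.zmultiples P).index : ℚ) ^ 2 * (W.torsionOrder : ℚ) ^ 2 /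
            (((W.baseChange ℝ).numRealComponents : ℚ) * (k : ℚ) ^ 2 *
              ((W.baseChange K).torsionOrder : ℚ) ^ 2 * (Dt.c : ℚ) ^ 2 *
              (Units.torsionOrder K : ℚ) ^ 2 * qd * |(Cd.u : ℚ)| * (W.tamagawaProduct : ℚ)) : ℚ) :
            ℂ) := by
  haveI hEK : (W.baseChange K).IsElliptic := isElliptic_baseChange' W K
  obtain ⟨h2, hKtc⟩ := hK
  haveI : IsTotallyComplex K := hKtc
  have hD0 : (NumberField.discr K : ℚ) ≠ 0 := by exact_mod_cast NumberField.discr_ne_zero K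
  haveI hEt : (W.quadraticTwist (NumberField.discr K : ℚ)).IsElliptic :=
    W.isElliptic_quadraticTwist hD0
  ---------------------------------------------------------------- `L`-values over `ℚ` and `K`
  have hL0 : W.entireLFunction 1 = 0 := entireLFunction_one_eq_zero_of_analyticRank_eq_one hr
  obtain ⟨hlead, hderiv⟩ := leadingLCoeff_eq_deriv_of_analyticRank_eq_one hr
  have hprod := lDerivEK_eq_deriv_mul W K hmod hL0
  have hLK : LDerivEK W K ≠ 0 := by
    rw [hprod]; exact mul_ne_zero hderiv hLt
  ---------------------------------------------------------------- Heegner point non-torsion; Kolyvagin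
  have hPH : IsHeegnerPoint N W K P := ⟨Dt, H, ι, hP⟩
  have hPinf : ¬ IsOfFinAddOrder P :=
    (lDerivEK_ne_zero_iff_not_isOfFinAddOrder W N K hGZ ⟨h2, hKtc⟩ hHN hPH).mp hLK
  obtain ⟨hrkK, hShaK⟩ := hKo ⟨h2, hKtc⟩ hHN hPH hPinf
  have hShaW : W.ShaFinite := Literature.NumberTheory.EllipticCurves.shaFinite_of_baseChange W K hShaK
  haveI hfinW : Finite W.sha := hShaW
  ---------------------------------------------------------------- heights and index, `2`-power exposed
  obtain ⟨k, hk12, hkiff, hheight⟩ :=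
    exists_halvingIndex_canonicalHeight_eq_index_sq_mul_regulator W K h2 hrkK hrQ P hPinf
  ---------------------------------------------------------------- Gross–Zagier and the period
  have hLD := (hGZ ⟨h2, hKtc⟩ hHN) Dt H ι P hP
  have hper := two_mul_covolume_div_sqrt_eq_bsdPeriod W K Dt h2
  have hΩ := W.realPeriod_mul_realPeriod_quadraticTwist_eq_mul_bsdPeriod K h2
  have hΩd : Wd.realPeriodRat =
      |((Cd.u : ℚ) : ℝ)| * (W.quadraticTwist (NumberField.discr K : ℚ)).realPeriodRat := by
    rw [← hWd]; exact realPeriodRat_smul_holds (W.quadraticTwist _) Cd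
  have hLt' : (W.quadraticTwist (NumberField.discr K : ℚ)).entireLFunction = Wd.entireLFunction := by
    rw [← hWd, entireLFunction_smul]
  ---------------------------------------------------------------- the twist's `L`-value
  have hΩdpos : 0 < Wd.realPeriodRat := Wd.realPeriodRat_pos_holds
  have hΩdC : (Wd.realPeriodRat : ℂ) ≠ 0 := by exact_mod_cast hΩdpos.ne'
  have hLd : Wd.entireLFunction 1 = (((qd : ℝ) * Wd.realPeriodRat : ℝ) : ℂ) := by
    have := (div_eq_iff hΩdC).mp hqd
    rw [this]; push_cast; ring
  have hLd1 : Wd.entireLFunction 1 ≠ 0 := by rw [← hLt']; exact hLt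
  have hqd0 : qd ≠ 0 := by
    intro h0
    apply hLd1
    rw [hLd, h0]; simp
  ---------------------------------------------------------------- positivity of everything
  have hΩW : 0 < W.realPeriodRat := W.realPeriodRat_pos_holds
  have hΩt : 0 < (W.quadraticTwist (NumberField.discr K : ℚ)).realPeriodRat :=
    (W.quadraticTwist _).realPeriodRat_pos_holds
  have hR : 0 < W.regulator := W.regulator_pos'
  have hcW : 0 < W.tamagawaProduct := W.tamagawaProduct_pos_holds
  have htW : 0 < W.torsionOrder := W.torsionOrder_pos_holds
  have htK : 0 < (W.baseChange K).torsionOrder := (W.baseChange K).torsionOrder_pos_holds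
  have hcM : (Dt.c : ℚ) ≠ 0 := by exact_mod_cast hc0
  have hw : 0 < Units.torsionOrder K := Units.torsionOrder_pos K
  have huu : (Cd.u : ℚ) ≠ 0 := Cd.u.ne_zero
  have hk0 : 0 < k := by rcases hk12 with rfl | rfl <;> norm_num
  have hI0 : (AddSubgroup.zmultiples P).index ≠ 0 := by
    intro hI
    rw [hI] at hheight
    have h0 : (k : ℝ) ^ 2 * ((W.baseChange K).torsionOrder : ℝ) ^ 2 * P.canonicalHeight = 0 := by
      rw [hheight]; simp
    have hh0 : P.canonicalHeight = 0 := by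
      rcases mul_eq_zero.mp h0 with h' | h'
      · rcases mul_eq_zero.mp h' with h'' | h''
        · exact absurd (pow_eq_zero_iff two_ne_zero |>.mp h'') (by exact_mod_cast hk0.ne')
        · exact absurd (pow_eq_zero_iff two_ne_zero |>.mp h'') (by exact_mod_cast htK.ne')
      · exact h'
    exact hPinf ((Affine.Point.canonicalHeight_eq_zero_iff_holds P).mp hh0)
  set n := (W.baseChange ℝ).numRealComponents with hn_def
  have hn : n = 1 ∨ n = 2 := numRealComponents_eq_one_or W
  have hn0 : 0 < n := by rcases hn with h' | h' <;> omega
  ---------------------------------------------------------------- the rational number `q = #Ш_an`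
  set I := (AddSubgroup.zmultiples P).index with hI_def
  set q : ℚ := 8 * (I : ℚ) ^ 2 * (W.torsionOrder : ℚ) ^ 2 /
      ((n : ℚ) * (k : ℚ) ^ 2 * ((W.baseChange K).torsionOrder : ℚ) ^ 2 * (Dt.c : ℚ) ^ 2 *
        (Units.torsionOrder K : ℚ) ^ 2 * qd * |(Cd.u : ℚ)| * (W.tamagawaProduct : ℚ)) with hq_def
  refine ⟨hShaW, k, hk12, hkiff, ?_⟩
  show shaAn W = (q : ℂ)
  ---------------------------------------------------------------- real abbreviations
  set ΩW := W.realPeriodRat with hΩW_def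
  set Ωt := (W.quadraticTwist (NumberField.discr K : ℚ)).realPeriodRat with hΩt_def
  set B := (W.baseChange K).bsdPeriod with hB_def
  set R := W.regulator with hR_def
  set hh := P.canonicalHeight with hhh_def
  set tK := (W.baseChange K).torsionOrder with htK_def
  set tW := W.torsionOrder with htW_def
  set cW := W.tamagawaProduct with hcW_def
  set w := Units.torsionOrder K with hw_def
  set cM := Dt.c with hcM_def
  set u := (Cd.u : ℚ) with hu_def
  have hΩW' : ΩW = (W.baseChange ℝ).realPeriod := rfl
  have hΩt' : Ωt = ((W.quadraticTwist (NumberField.discr K : ℚ)).baseChange ℝ).realPeriod := rfl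
  rw [← hΩW', ← hΩt'] at hΩ
  -- `B = ΩW Ωt / n`, `ĥ = 2 I² R / (k² tK²)`, the Gross–Zagier constant `= 4 B / (c² w²)`
  have hBeq : B = ΩW * Ωt / n := by
    rw [hΩ]; field_simp
  have hheq : hh = 2 * (I : ℝ) ^ 2 * R / ((k : ℝ) ^ 2 * (tK : ℝ) ^ 2) := by
    rw [← hheight]; field_simp
  have hGZc : 2 * ZLattice.covolume Dt.L.lattice /
        ((cM : ℝ) ^ 2 * ((w : ℝ) / 2) ^ 2 * √|(NumberField.discr K : ℝ)|) =
      4 * B / ((cM : ℝ) ^ 2 * (w : ℝ) ^ 2) := by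
    rw [← hper]; field_simp; ring
  -- the `L`-values as real numbers
  have hLdr : Wd.entireLFunction 1 = (((qd : ℝ) * (|(u : ℝ)| * Ωt) : ℝ) : ℂ) := by
    rw [hLd, hΩd]
  have hLdne : ((qd : ℝ) * (|(u : ℝ)| * Ωt) : ℝ) ≠ 0 := by
    have hu' : |(u : ℝ)| ≠ 0 := abs_ne_zero.mpr (by exact_mod_cast huu)
    have hqd' : (qd : ℝ) ≠ 0 := by exact_mod_cast hqd0
    exact mul_ne_zero hqd' (mul_ne_zero hu' hΩt.ne')
  set X : ℝ := (4 * B / ((cM : ℝ) ^ 2 * (w : ℝ) ^ 2) * hh) / ((qd : ℝ) * (|(u : ℝ)| * Ωt))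
    with hX_def
  have hL1 : deriv W.entireLFunction 1 = ((X : ℝ) : ℂ) := by
    have hne : ((((qd : ℝ) * (|(u : ℝ)| * Ωt) : ℝ)) : ℂ) ≠ 0 := by exact_mod_cast hLdne
    have key : deriv W.entireLFunction 1 * ((((qd : ℝ) * (|(u : ℝ)| * Ωt) : ℝ)) : ℂ) =
        ((4 * B / ((cM : ℝ) ^ 2 * (w : ℝ) ^ 2) * hh : ℝ) : ℂ) := by
      rw [← hLdr, ← hLt', ← hprod, hLD, hGZc]
    rw [hX_def, Complex.ofReal_div, ← key, mul_div_cancel_right₀ _ hne]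
  have hshaAnR : shaAn W = ((X * (tW : ℝ) ^ 2 / (ΩW * (cW : ℝ) * R) : ℝ) : ℂ) := by
    rw [shaAn_def, hlead, hL1]
    push_cast
    rfl
  have hXq : X * (tW : ℝ) ^ 2 / (ΩW * (cW : ℝ) * R) = (q : ℝ) := by
    have hn' : (n : ℝ) ≠ 0 := by exact_mod_cast hn0.ne'
    have hk' : (k : ℝ) ≠ 0 := by exact_mod_cast hk0.ne'
    have htK' : (tK : ℝ) ≠ 0 := by exact_mod_cast htK.ne'
    have htW' : (tW : ℝ) ≠ 0 := by exact_mod_cast htW.ne'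
    have hcW' : (cW : ℝ) ≠ 0 := by exact_mod_cast hcW.ne'
    have hcM' : (cM : ℝ) ≠ 0 := by exact_mod_cast hc0
    have hw' : (w : ℝ) ≠ 0 := by exact_mod_cast hw.ne'
    have hu' : |(u : ℝ)| ≠ 0 := abs_ne_zero.mpr (by exact_mod_cast huu)
    have hI' : (I : ℝ) ≠ 0 := by exact_mod_cast hI0
    have hqd' : (qd : ℝ) ≠ 0 := by exact_mod_cast hqd0
    rw [hX_def, hheq, hBeq, hq_def]
    push_cast
    field_simp
    ring
  rw [hshaAnR, hXq]; norm_cast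

/-- **`BSD(E, 2)` OF A RANK-ONE PAIR ⟺ ONE EXPLICIT `2`-ADIC VALUATION, GZK binder replaced by
`hrQ : W.mordellWeilRank = 1`** — verbatim `Summit.BirchSwinnertonDyer.Rank1Residual.P2.bsdp_two_iff_of_heegner_rankOne`
otherwise. In the setting of `shaAn_eq_heegnerIndexFormula_two_of_rank`: `BSDp W 2` holds iff
`ord₂(8 I² t_W² / (n k² t_K² c² w² q_d |u| c_W)) = ord₂ #Ш(E)` for the `k ∈ {1,2}` of the
halvability bit (the rank part and the finiteness of `Ш` being Gross–Zagier–Kolyvagin). Every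
quantity on the left is an output of the lane's exact engines (index of the Heegner point by
`2`-saturation in `E(K)`, torsion of `E(ℚ)` and `E(K)`, `c_∞`, the halvability bit, the Manin
constant, `w_K`, the twin's modular-symbol value `L(E^{d_K},1)/Ω`, the minimalising scalar of the
twist, Tamagawa numbers); the right side is the `2`-descent output. A per-pair statement; it closes
no class. [cite: Miller2011LMS, Def. 1.1] [cite: GrossZagier1986, V.§2] -/
theorem bsdp_two_iff_of_heegner_rankOne_of_rank
    (W : WeierstrassCurve ℚ) [W.IsElliptic] [W.IsGloballyMinimal]
    (N : ℕ) [NeZero N] (K : Type) [Field K] [NumberField K]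
    (Dt : ModularParametrizationData W N) (H : HeegnerDatum N (NumberField.discr K)) (ι : K →+* ℂ)
    (P : (W.baseChange K).toAffine.Point)
    (hGZ : gross_zagier N W K) (hKo : kolyvagin N W K) (hmod : hasEntireLFunction_rat)
    (hK : IsImaginaryQuadratic K) (hHN : SatisfiesHeegnerHypothesis N K)
    (hP : WeierstrassCurve.Affine.Point.map ι.toRatAlgHom P = heegnerPointComplex Dt H)
    (hc0 : Dt.c ≠ 0) (hr : W.analyticRank = 1) (hrQ : W.mordellWeilRank = 1)
    (hLt : (W.quadraticTwist (NumberField.discr K : ℚ)).entireLFunction 1 ≠ 0)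
    (Wd : WeierstrassCurve ℚ) [Wd.IsElliptic] [Wd.IsGloballyMinimal] (Cd : VariableChange ℚ)
    (hWd : Cd • W.quadraticTwist (NumberField.discr K : ℚ) = Wd)
    (qd : ℚ) (hqd : Wd.entireLFunction 1 / (Wd.realPeriodRat : ℂ) = (qd : ℂ)) :
    ∃ k : ℕ, (k = 1 ∨ k = 2) ∧
      (k = 2 ↔ ∀ y : W.toAffine.Point, ∃ Q : (W.baseChange K).toAffine.Point,
        QuadraticDescent.incl K W y - (2 : ℤ) • Q ∈
          AddCommGroup.torsion (W.baseChange K).toAffine.Point) ∧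
      (BSDp W 2 ↔
        padicValRat 2
            (8 * ((AddSubgroup.zmultiples P).index : ℚ) ^ 2 * (W.torsionOrder : ℚ) ^ 2 /
              (((W.baseChange ℝ).numRealComponents : ℚ) * (k : ℚ) ^ 2 *
                ((W.baseChange K).torsionOrder : ℚ) ^ 2 * (Dt.c : ℚ) ^ 2 *
                (Units.torsionOrder K : ℚ) ^ 2 * qd * |(Cd.u : ℚ)| * (W.tamagawaProduct : ℚ))) =
          padicValNat 2 (Nat.card W.sha)) := by
  obtain ⟨hfin, k, hk12, hkiff, hsha⟩ := shaAn_eq_heegnerIndexFormula_two_of_rank W N K Dt H ι P hGZ hKo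
    hmod hK hHN hP hc0 hr hrQ hLt Wd Cd hWd qd hqd
  haveI := hfin
  haveI : Fact (2 : ℕ).Prime := ⟨Nat.prime_two⟩
  refine ⟨k, hk12, hkiff, ?_⟩
  have hrank : W.mordellWeilRank = W.analyticRank := by rw [hrQ, hr]
  have hprim : padicValNat 2 (Nat.card (AddCommGroup.primaryComponent W.sha 2)) =
      padicValNat 2 (Nat.card W.sha) := padicValNat_card_addPrimaryComponent 2
  constructor
  · rintro ⟨-, -, q, hq, hv⟩
    have hqq := Rat.cast_injective (α := ℂ) (hq.symm.trans hsha)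
    rw [← hqq, hv, hprim]
  · intro hv
    exact ⟨hrank, Finite.of_injective _ Subtype.val_injective, _, hsha, by rw [hv, hprim]⟩

end Summit.BirchSwinnertonDyer.BirchSwinnertonDyer.Theorems.RankOneAtTwoOneDoor

end
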